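import Summits.BirchSwinnertonDyer.BirchSwinnertonDyer.Theses.TameQuarticManinParity
import Literature.NumberTheory.EllipticCurves.ModularJacobianNeronDifferentialsTameProofs
import HarnessLib

/-!
# Route `TameQuarticManinParity`, LINE 41 price (critic #255 (1), endorsed #266): C41 — E41 ⟹ COL(III), PROVED BY NAME
# (the planner's `Glue41c.lean`; not filed as an item, landed `--supports` COL(III) stmt-BirchSwinnertonDyer-24044)

Cell `pub/bsd-wall`, D-0145 line `route-BirchSwinnertonDyer-TeichmullerTwistDescent`, seat `bsd-line-ttd-p1` g15.
BSD is NOT proved by this; Manin's conjecture is not proved by this; E41 (`TprimeTameThreeOptimalManinUnit`, stmt-24070)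
and COL(III) (`TprimeIIIColengthBound`, stmt-24044) stay OPEN — this file records that they are EQUIVALENT FORMS over
the carrier: COL(III) ⟹ E41 is the landed glue G41a (with N38c, S41, `nonempty_tameNeronFormsAt`), and E41 ⟹ COL(III)
is N38c's forward direction (`not_dvd_maninConstant_iff_tameColength_le_of_hasTameGoodModel`, `a = 2`, `e = 8`).
THEOREMS ONLY; no definition, no named fact, no `sorry`; axioms `propext`, `Classical.choice`, `Quot.sound`.
-/

set_option autoImplicit false
-- D-0017: single-problem summit, so `Summit.BirchSwinnertonDyer.BirchSwinnertonDyer.…` repeats a namespace BY DESIGN.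
set_option linter.dupNamespace false

namespace Summit.BirchSwinnertonDyer.BirchSwinnertonDyer.Theorems.TameQuarticManinParity

open Summit.BirchSwinnertonDyer.BirchSwinnertonDyer.Theses.TameQuarticManinParity
open Literature.NumberTheory.EllipticCurves.ModularForms

/-- **C41**, by name: E41 ⟹ COL(III) — on a Kodaira-III (t′) row with good model
of exponent `2`, `3 ∤ c` gives `col_K ≤ 2` by N38c. [cite: EdixhovenManin1991, §4 Prop. 8] -/
theorem tprimeIIIColengthBound_of_tameThreeOptimalManinUnit :
    TprimeTameThreeOptimalManinUnit → TprimeIIIColengthBound := by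
  unfold TprimeIIIColengthBound
  intro h41 W _ _ _ hadd ht h3 hgood Λ D hopt hmin hdeg
  exact (Λ.not_dvd_maninConstant_iff_tameColength_le_of_hasTameGoodModel Nat.prime_three (by norm_num)
    D hopt hgood).1 (h41 W hadd ht h3 D hopt hmin hdeg)

end Summit.BirchSwinnertonDyer.BirchSwinnertonDyer.Theorems.TameQuarticManinParity
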